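import Mathlib
import Literature.AlgebraicGeometry.Resolution.FormalFibres
import Summits.Langlands.Langlands.Theorems.SkinnerWilesDefectOneReducibleOrdinaryProModularRegularSequenceConnectedness
import Summits.Langlands.Langlands.Theorems.SkinnerWilesDefectOneReducibleOrdinaryProModularRaynaudConnectivityAux

/-!
# Grothendieck's connectedness theorem, (G1) "on est ramené au cas où `X` est intègre" — lemmas

Route `SkinnerWilesDefectOne`, crux `ReducibleOrdinaryProModular` (stmt-Langlands-12919), line
`fine-selmer-codimension-two`, registered stub (R) `stub_raynaudConnectedness`, sub-goal (G1)
`stub_raynaudConnectedness_auxComponents` of the programme proving Grothendieck's connectedness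
theorem [SGA2 XIII 2.1] (`Literature.RingTheory.LocalCohomology.GrothendieckConnectedness`): the
reduction of (a_{k−m}), (b_{k−m}) for `Spec A/(f₁,…,f_m)` to the case of a complete local DOMAIN.  This
file collects the sorry-free bookkeeping used by the sequel `…ConnectednessComponents.lean`:

* `Theorems.ringKrullDim_quotient_comap_eq_of_surjective`, `…_map_eq_of_surjective` — dimensions of
  quotients along a surjection `A ↠ B` (`A ⧸ f⁻¹ I ≃ B ⧸ I`);
* `Theorems.mem_minimalPrimes_ker_iff_of_surjective` — primes minimal over `ker f` are the pull-backs
  of the minimal primes of `B`; `Theorems.comap_mem_minimalPrimes_of_quotient`,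
  `Theorems.mem_minimalPrimes_of_le_of_le`;
* `Theorems.quotQuotOfList_surjective`, `Theorems.ker_quotQuotOfList` — the composite surjection
  `θ_P : A ↠ A ⧸ P ↠ (A ⧸ P) ⧸ (f̄₁,…,f̄_m)` has kernel `P + (f₁,…,f_m)`;
* `Theorems.le_ringKrullDim_quotient_of_mem_minimalPrimes_sup_ofList` — **the domain step**: granted
  the statement (A1) "in a complete Noetherian local domain `D` with `e + m ≤ dim D` every minimal
  prime `Q` of `D/(f₁,…,f_m)` has `e ≤ dim (D/(f))/Q`" (registered sub-goal
  `stub_raynaudConnectedness_auxDomainComponentDim`, taken here as a HYPOTHESIS), for every prime `P`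
  of a complete Noetherian local ring `A` with `e + m ≤ dim A/P`, every prime `𝔮` minimal over
  `P + (f₁,…,f_m)` has `e ≤ dim A/𝔮` (apply (A1) to `D = A/P`, complete by
  `Literature.….isAdicComplete_quotient`, and transport along `θ_P`);
* `FineSelmerCodimensionTwo.stub_raynaudConnectedness_auxComponentsLemmas` (registered auxiliary
  sub-goal) — the dimension transport `dim A ⧸ f⁻¹ I = dim B ⧸ I` at universe `0`.

("`dim A/I` is attained at a minimal prime of `I`" is the tree's
`Theorems.exists_minimalPrimes_le_ringKrullDim_quotient`, file `…RaynaudConnectivityAux.lean`.)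

References: A. Grothendieck, SGA 2, Exp. XIII Thm. 2.1 and its proof ("on est ramené au cas où `X`
est intègre") [Grothendieck1968SGA2]; M. Brodmann, R. Sharp, *Local cohomology*, 19.2 [BrodmannSharp1998].
-/

set_option linter.dupNamespace false -- project-wide option (lakefile weak.linter.dupNamespace); `Summit.Langlands.Langlands` is the mandated namespace
set_option autoImplicit false

namespace Summit.Langlands.Langlands.Theorems

open IsLocalRing

universe u v

section General

variable {A : Type u} [CommRing A]

/-! ## 1. Dimensions of quotients along a surjection -/

/-- Along a surjection `f : A ↠ B`, `dim A ⧸ f⁻¹(I) = dim B ⧸ I` (`A ⧸ f⁻¹ I ≃ B ⧸ I`). [folklore] -/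
theorem ringKrullDim_quotient_comap_eq_of_surjective {B : Type v} [CommRing B] {f : A →+* B}
    (hf : Function.Surjective f) (I : Ideal B) :
    ringKrullDim (A ⧸ I.comap f) = ringKrullDim (B ⧸ I) := by
  have hker : I.comap f = RingHom.ker ((Ideal.Quotient.mk I).comp f) := by
    rw [← RingHom.comap_ker, Ideal.mk_ker]
  exact ringKrullDim_eq_of_ringEquiv ((Ideal.quotEquivOfEq hker).trans
    (RingHom.quotientKerEquivOfSurjective (Ideal.Quotient.mk_surjective.comp hf)))

/-- Along a surjection `f : A ↠ B`, `dim B ⧸ f(K) = dim A ⧸ K` for `K ⊇ ker f`. [folklore] -/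
theorem ringKrullDim_quotient_map_eq_of_surjective {B : Type v} [CommRing B] {f : A →+* B}
    (hf : Function.Surjective f) {K : Ideal A} (hK : RingHom.ker f ≤ K) :
    ringKrullDim (B ⧸ K.map f) = ringKrullDim (A ⧸ K) := by
  rw [← ringKrullDim_quotient_comap_eq_of_surjective hf, Ideal.comap_map_of_surjective' f hf,
    sup_eq_left.mpr hK]

/-! ## 2. Minimal primes along a surjection -/

/-- For a surjection `f : A ↠ B`, the primes of `A` minimal over `ker f` are exactly the pull-backs of
the minimal primes of `B`. [folklore] -/
theorem mem_minimalPrimes_ker_iff_of_surjective {B : Type v} [CommRing B] {f : A →+* B}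
    (hf : Function.Surjective f) (q : Ideal A) :
    q ∈ (RingHom.ker f).minimalPrimes ↔ ∃ Q ∈ minimalPrimes B, Q.comap f = q := by
  rw [RingHom.ker_eq_comap_bot, Ideal.comap_minimalPrimes_eq_of_surjective hf]
  constructor
  · rintro ⟨Q, hQ, rfl⟩
    exact ⟨Q, hQ, rfl⟩
  · rintro ⟨Q, hQ, rfl⟩
    exact ⟨Q, hQ, rfl⟩

/-- The pull-back to `A` of a minimal prime of `A ⧸ I` is a prime minimal over `I`. [folklore] -/
theorem comap_mem_minimalPrimes_of_quotient {I : Ideal A} {Q : Ideal (A ⧸ I)}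
    (hQ : Q ∈ minimalPrimes (A ⧸ I)) : Q.comap (Ideal.Quotient.mk I) ∈ I.minimalPrimes := by
  rw [Ideal.minimalPrimes_eq_comap]
  exact ⟨Q, hQ, rfl⟩

/-- A prime minimal over `I` is minimal over every ideal between `I` and itself. [folklore] -/
theorem mem_minimalPrimes_of_le_of_le {I K q : Ideal A} (hq : q ∈ I.minimalPrimes) (hIK : I ≤ K)
    (hKq : K ≤ q) : q ∈ K.minimalPrimes :=
  ⟨⟨hq.1.1, hKq⟩, fun _ hr hrq => hq.2 ⟨hr.1, hIK.trans hr.2⟩ hrq⟩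

/-- The composite `θ_P : A ↠ A ⧸ P ↠ (A ⧸ P) ⧸ (f̄₁,…,f̄_m)` is surjective. [folklore] -/
theorem quotQuotOfList_surjective (P : Ideal A) (fs : List A) :
    Function.Surjective ((Ideal.Quotient.mk (Ideal.ofList (fs.map (Ideal.Quotient.mk P)))).comp
      (Ideal.Quotient.mk P)) :=
  Ideal.Quotient.mk_surjective.comp Ideal.Quotient.mk_surjective

/-- The composite `θ_P : A ↠ A ⧸ P ↠ (A ⧸ P) ⧸ (f̄₁,…,f̄_m)` has kernel `P + (f₁,…,f_m)`. [folklore] -/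
theorem ker_quotQuotOfList (P : Ideal A) (fs : List A) :
    RingHom.ker ((Ideal.Quotient.mk (Ideal.ofList (fs.map (Ideal.Quotient.mk P)))).comp
      (Ideal.Quotient.mk P)) = P ⊔ Ideal.ofList fs := by
  rw [← RingHom.comap_ker, Ideal.mk_ker, ← Ideal.map_ofList,
    Ideal.comap_map_of_surjective' _ Ideal.Quotient.mk_surjective, Ideal.mk_ker, sup_comm]

/-- Primes of `A` minimal over `P + (f₁,…,f_m)` are the pull-backs along `θ_P` of the minimal primes
of `(A ⧸ P) ⧸ (f̄₁,…,f̄_m)`. [folklore] -/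
theorem mem_minimalPrimes_sup_ofList_iff (P : Ideal A) (fs : List A) (q : Ideal A) :
    q ∈ (P ⊔ Ideal.ofList fs).minimalPrimes ↔
      ∃ Q ∈ minimalPrimes ((A ⧸ P) ⧸ Ideal.ofList (fs.map (Ideal.Quotient.mk P))),
        Q.comap ((Ideal.Quotient.mk (Ideal.ofList (fs.map (Ideal.Quotient.mk P)))).comp
          (Ideal.Quotient.mk P)) = q := by
  rw [← ker_quotQuotOfList P fs]
  exact mem_minimalPrimes_ker_iff_of_surjective (quotQuotOfList_surjective P fs) q

end General

/-! ## 3. The domain step -/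

section DomainStep

variable {A : Type} [CommRing A] [IsNoetherianRing A] [IsLocalRing A]
  [IsAdicComplete (maximalIdeal A) A]

/-- **The domain step of SGA2 XIII 2.1 ("on est ramené au cas où `X` est intègre").**  Let `A` be a
complete Noetherian local ring, `f₁, …, f_m ∈ 𝔪`, and grant (A1): in every complete Noetherian local
DOMAIN `D` with `e + m ≤ dim D`, every minimal prime `Q` of `D/(f₁,…,f_m)` (`f_i ∈ 𝔪_D`) has
`e ≤ dim (D/(f))/Q` (registered sub-goal `stub_raynaudConnectedness_auxDomainComponentDim`, a
hypothesis here).  Then for every prime `P` of `A` with `e + m ≤ dim A/P`, every prime `𝔮` of `A`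
minimal over `P + (f₁,…,f_m)` has `e ≤ dim A/𝔮`: apply (A1) to the complete local domain `D = A/P`
(`Literature.….isAdicComplete_quotient`) and transport along `θ_P : A ↠ (A/P)/(f̄)`, whose kernel is
`P + (f)`. [cite: Grothendieck1968SGA2, Exp. XIII Thm. 2.1] -/
theorem le_ringKrullDim_quotient_of_mem_minimalPrimes_sup_ofList
    (hA1 : ∀ (D : Type) [CommRing D] [IsDomain D] [IsNoetherianRing D] [IsLocalRing D]
      [IsAdicComplete (IsLocalRing.maximalIdeal D) D] (fs : List D) (e : ℕ),
      (∀ f ∈ fs, f ∈ IsLocalRing.maximalIdeal D) →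
      ((e + fs.length : ℕ) : WithBot ℕ∞) ≤ ringKrullDim D →
      ∀ Q : Ideal (D ⧸ Ideal.ofList fs), Q ∈ minimalPrimes (D ⧸ Ideal.ofList fs) →
        (e : WithBot ℕ∞) ≤ ringKrullDim ((D ⧸ Ideal.ofList fs) ⧸ Q))
    {fs : List A} (hfs : ∀ f ∈ fs, f ∈ maximalIdeal A) {P : Ideal A} (hP : P.IsPrime) {e : ℕ}
    (he : ((e + fs.length : ℕ) : WithBot ℕ∞) ≤ ringKrullDim (A ⧸ P))
    {q : Ideal A} (hq : q ∈ (P ⊔ Ideal.ofList fs).minimalPrimes) :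
    (e : WithBot ℕ∞) ≤ ringKrullDim (A ⧸ q) := by
  -- `D = A ⧸ P` is a complete Noetherian local domain
  have hPm : P ≤ maximalIdeal A := IsLocalRing.le_maximalIdeal hP.ne_top
  haveI : IsLocalRing (A ⧸ P) := (isLocalRing_quotient_of_le_maximalIdeal hPm).2
  haveI : IsAdicComplete (maximalIdeal (A ⧸ P)) (A ⧸ P) :=
    Literature.AlgebraicGeometry.Resolution.isAdicComplete_quotient P
  -- the images `f̄ᵢ ∈ 𝔪_D`
  have hfs' : ∀ f ∈ fs.map (Ideal.Quotient.mk P), f ∈ maximalIdeal (A ⧸ P) := by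
    intro f hf
    obtain ⟨g, hg, rfl⟩ := List.mem_map.mp hf
    exact mk_mem_maximalIdeal_quotient_of_le hPm (hfs g hg)
  have he' : ((e + (fs.map (Ideal.Quotient.mk P)).length : ℕ) : WithBot ℕ∞) ≤
      ringKrullDim (A ⧸ P) := by
    rwa [List.length_map]
  -- `q = θ_P⁻¹ Q` for a minimal prime `Q` of `(A/P)/(f̄)`
  obtain ⟨Q, hQ, rfl⟩ := (mem_minimalPrimes_sup_ofList_iff P fs q).mp hq
  rw [ringKrullDim_quotient_comap_eq_of_surjective (quotQuotOfList_surjective P fs)]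
  exact hA1 (A ⧸ P) (fs.map (Ideal.Quotient.mk P)) e hfs' he' Q hQ

end DomainStep

end Summit.Langlands.Langlands.Theorems

/-! ## 4. The registered auxiliary sub-goal (verbatim signature) -/

namespace Summit.Langlands.Langlands.Cruxes.ReducibleOrdinaryProModular.FineSelmerCodimensionTwo

/-- **Registered auxiliary sub-goal `stub_raynaudConnectedness_auxComponentsLemmas`** of stub (R)
`stub_raynaudConnectedness` (programme SGA2 XIII 2.1, step (G1)): dimensions of quotients along a
surjection `f : A ↠ B`, `dim A ⧸ f⁻¹ I = dim B ⧸ I` —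
`Theorems.ringKrullDim_quotient_comap_eq_of_surjective` at universe `0`. [folklore] -/
theorem stub_raynaudConnectedness_auxComponentsLemmas :
    ∀ (A : Type) [CommRing A] (B : Type) [CommRing B] (f : A →+* B), Function.Surjective f →
      ∀ I : Ideal B, ringKrullDim (A ⧸ I.comap f) = ringKrullDim (B ⧸ I) :=
  fun _ _ _ _ _ hf I =>
    Summit.Langlands.Langlands.Theorems.ringKrullDim_quotient_comap_eq_of_surjective hf I

end Summit.Langlands.Langlands.Cruxes.ReducibleOrdinaryProModular.FineSelmerCodimensionTwo
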